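import Summits.BirchSwinnertonDyer.BirchSwinnertonDyer.Theorems.Rank1ResidualX1Defs
import Literature.NumberTheory.EllipticCurves.Rank1Residual.X1MainConjecture

/-!
# Rank-≤1 BSD residual class X1 ∩ {r = 0}: the typed MISSING INPUT and the typed TARGET coincide

HONEST FRAMING (cell `b2b-bsdres`, home `run/shared/lean/b2b/bsd-rank1-residual/`, unit
`b2b-bsdres-x1b`, prover B = the independent patchwork, no Keller–Yin input). The goal is to DELETE
the COMBINATION-SHAPED residual classes for ALL analytic-rank `≤ 1` curves over `ℚ` — "full BSD
formula for every rank `≤ 1` curve in class C" assembled STRICTLY from published theorems — so that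
the rank-`≤ 1` remainder becomes exactly the CONSTRUCTION-SHAPED classes, which are TYPED
(missing-input `Prop`s), NOT attempted; this is not "finishing BSD". Helper file of the crux
`PAdicOrderMainConjectureR5` (stmt-BirchSwinnertonDyer-15418, the cyclotomic main conjecture at good
ordinary `p ≥ 5` with `E[p]` IRREDUCIBLE), companion of prover A's `Rank1ResidualX1Defs` (same item),
which TYPED the reducible anomalous counterpart `MazurMainConjecture W p` /
`MazurMainConjectureOnX1TypeA` as the missing input of class X1 and `BSDpOnClassX1` as the target.

Theorems only, in prover A's vocabulary, from the Literature file
`Rank1Residual/X1MainConjecture.lean` (prover B: the converse of the chain Wuthrich 2014 Thm. 16 +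
Greenberg 1999 Thm. 4.1 — the cofactor of Kato–Wuthrich's integral divisibility is a unit of `Λ` as
soon as the two sides of the rank-`0` BSD formula have the same `p`-adic valuation):

* `mazurMainConjecture_iff_bsdp` — at every X1 pair of analytic rank `0`,
  `MazurMainConjecture W p ↔ BSDp W p`, granted the PUBLISHED named facts Wuthrich 2014 Thm. 16
  (`Wuthrich2014.charIdeal_dvd_padicLFunction`), Greenberg 1999 Thm. 4.1
  (`greenberg_charValue_rankZero`), modularity (`nonempty_modularParametrizationData`),
  Gross–Zagier–Kolyvagin (`rank_eq_analyticRank_of_analyticRank_le_one`);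
* `mazurMainConjecture_iff_missingInputAt` — the same with prover B's typed residual
  `Typed.X1.MissingInputAt W p` on the right: the two provers' typed inputs are ONE statement on
  X1 ∩ {r = 0};
* `mazurMainConjectureOnX1_rankZero_iff`, `mazurMainConjectureOnX1TypeA_rankZero_iff` — class level:
  "Mazur's main conjecture at every rank-`0` X1 pair (all of type A)" ⟺ "the rank-`0` half of
  `BSDpOnClassX1`"; in particular `BSDpOnClassX1` IMPLIES `MazurMainConjectureOnX1TypeA` on
  `r_an = 0` (converse of `bsdp_of_classX1_typeA_of_analyticRank_eq_zero`);
* `mazurMainConjecture_of_shaAn_unit`, `mazurMainConjecture_of_isIsogenous_of_shaAn_unit` — per-pair: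
  `MazurMainConjecture W p` is a THEOREM of the published record (+ Wuthrich Prop. 21, + Cassels) at
  every rank-`0` X1 pair with `p ∤ #Ш(E'/ℚ)_an` for some `ℚ`-isogenous `E'`; on the census of the
  cell (conductor `< 10⁴`) these are all 300 rank-`0` X1 pairs, including `11a1@5`, `14a1@3`,
  `26b1@7` — the anomalous type-A primes excluded by Greenberg–Vatsal 2000 Thm. 1.3 and
  Castella–Grossi–Skinner 2025 Thm. 1.

References: [Wuthrich2014] Thm. 16, Prop. 21; [GreenbergLNM1716] Thm. 4.1, §5 (closing examples);
[CastellaEtAl2021] Thm. 5.1.4; [CastellaGrossiSkinner2025] (MC), Thm. 1; [KellerYin2024] §0.5;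
[Miller2011LMS] Def. 1.1; [MilneADT2006] Thm. I.7.3.
-/

noncomputable section

open scoped Classical MatrixGroups ModularForm

open CongruenceSubgroup WeierstrassCurve Literature.NumberTheory.EllipticCurves
  Literature.NumberTheory.EllipticCurves.ModularForms Literature.NumberTheory.EllipticCurves.Rank1Residual
  Literature.NumberTheory.EllipticCurves.Rank1Residual.Typed
  Summit.BirchSwinnertonDyer.BirchSwinnertonDyer.Theorems.Rank1ResidualX1Defs

set_option linter.dupNamespace false
set_option autoImplicit false

namespace Summit.BirchSwinnertonDyer.BirchSwinnertonDyer.Theorems.Rank1ResidualX1Converse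

/-- **X1 ∩ {r = 0}: the typed missing input IS the typed target, pair by pair.** For `W/ℚ` globally
minimal elliptic and a prime `p` with `ClassX1 W p` and `ord_{s=1} L(E,s) = 0`, granted the PUBLISHED
named facts Wuthrich 2014 Thm. 16 (`hW16`), Greenberg 1999 Thm. 4.1 (`hGr`), modularity with an
integral Manin constant (`hmod`) and Gross–Zagier–Kolyvagin (`hGZK`):
`MazurMainConjecture W p ↔ BSDp W p`. (⇒: Castella–Grossi–Lee–Skinner's glue, prover A; ⇐: the
converse chain, prover B, `Rank1Residual.X1.mainConjecture_iff_bsdp`.)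
[cite: GreenbergLNM1716, Thm. 4.1 and §5 (closing examples)] [cite: Wuthrich2014, Thm. 16 (p. 393)]
[cite: CastellaEtAl2021, Thm. 5.1.4 (proof)] -/
theorem mazurMainConjecture_iff_bsdp (hW16 : Wuthrich2014.charIdeal_dvd_padicLFunction)
    (hGr : greenberg_charValue_rankZero) (hmod : nonempty_modularParametrizationData)
    (hGZK : rank_eq_analyticRank_of_analyticRank_le_one)
    (W : WeierstrassCurve ℚ) [W.IsElliptic] [W.IsGloballyMinimal] (p : ℕ) [Fact p.Prime]
    (hX1 : ClassX1 W p) (hr0 : W.analyticRank = 0) :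
    MazurMainConjecture W p ↔ BSDp W p :=
  X1.mainConjecture_iff_bsdp hW16 hGr hmod hGZK W p hX1 hr0

/-- **X1 ∩ {r = 0}: prover A's typed input ⟺ prover B's typed residual** (`Typed.X1.MissingInputAt`,
whose rank-`0` clause is `ord_p #Ш(E/ℚ)_an ≤ ord_p #Ш(E/ℚ)`), same facts.
[cite: GreenbergLNM1716, Thm. 4.1 and §5 (closing examples)] [cite: Wuthrich2014, Thm. 16 (p. 393)] -/
theorem mazurMainConjecture_iff_missingInputAt (hW16 : Wuthrich2014.charIdeal_dvd_padicLFunction)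
    (hGr : greenberg_charValue_rankZero) (hmod : nonempty_modularParametrizationData)
    (hGZK : rank_eq_analyticRank_of_analyticRank_le_one)
    (W : WeierstrassCurve ℚ) [W.IsElliptic] [W.IsGloballyMinimal] (p : ℕ) [Fact p.Prime]
    (hX1 : ClassX1 W p) (hr0 : W.analyticRank = 0) :
    MazurMainConjecture W p ↔ X1.MissingInputAt W p :=
  X1.mainConjecture_iff_missingInputAt hW16 hGr hmod hGZK W p hX1 hr0

/-- **Class level: Mazur's main conjecture on X1 ∩ {r = 0} ⟺ the rank-`0` half of the class
statement `BSDpOnClassX1`** (same published facts). Neither side is in print (REFEREE R6.4/R7.2: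
X1b, missing object "Mazur's cyclotomic main conjecture at an anomalous Eisenstein prime of type A");
this theorem says the missing object is EXACTLY that — nothing weaker deletes X1 ∩ {r = 0}, nothing
stronger is needed. [cite: GreenbergLNM1716, Thm. 4.1 and §5 (closing examples)]
[cite: Wuthrich2014, Thm. 16 (p. 393)] [cite: KellerYin2024, §0.5 (prose claim)] -/
theorem mazurMainConjectureOnX1_rankZero_iff (hW16 : Wuthrich2014.charIdeal_dvd_padicLFunction)
    (hGr : greenberg_charValue_rankZero) (hmod : nonempty_modularParametrizationData)
    (hGZK : rank_eq_analyticRank_of_analyticRank_le_one) :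
    (∀ (W : WeierstrassCurve ℚ) [W.IsElliptic] [W.IsGloballyMinimal] (p : ℕ) [Fact p.Prime],
      ClassX1 W p → W.analyticRank = 0 → MazurMainConjecture W p) ↔
    (∀ (W : WeierstrassCurve ℚ) [W.IsElliptic] [W.IsGloballyMinimal] (p : ℕ) [Fact p.Prime],
      ClassX1 W p → W.analyticRank = 0 → BSDp W p) :=
  X1.forall_mainConjecture_iff_forall_bsdp hW16 hGr hmod hGZK

/-- **The type-A phrasing**: within X1, `r_an = 0` forces parity type A (class clause
`¬(r = 0 ∧ gvpar)`), so "`MazurMainConjectureOnX1TypeA` restricted to `r_an = 0`" ⟺ "the rank-`0`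
half of `BSDpOnClassX1`" (same published facts). [cite: KellerYin2024, §0.5 (prose claim)]
[cite: GreenbergLNM1716, Thm. 4.1 and §5 (closing examples)] -/
theorem mazurMainConjectureOnX1TypeA_rankZero_iff (hW16 : Wuthrich2014.charIdeal_dvd_padicLFunction)
    (hGr : greenberg_charValue_rankZero) (hmod : nonempty_modularParametrizationData)
    (hGZK : rank_eq_analyticRank_of_analyticRank_le_one) :
    (∀ (W : WeierstrassCurve ℚ) [W.IsElliptic] [W.IsGloballyMinimal] (p : ℕ) [Fact p.Prime],
      ClassX1 W p → ¬ GVPar W p → W.analyticRank = 0 → MazurMainConjecture W p) ↔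
    (∀ (W : WeierstrassCurve ℚ) [W.IsElliptic] [W.IsGloballyMinimal] (p : ℕ) [Fact p.Prime],
      ClassX1 W p → W.analyticRank = 0 → BSDp W p) := by
  rw [← mazurMainConjectureOnX1_rankZero_iff hW16 hGr hmod hGZK]
  constructor
  · intro h W _ _ p _ hX1 hr0
    exact h W p hX1 (fun hgv ↦ hX1.2.2.2.2 ⟨hr0, hgv⟩) hr0
  · intro h W _ _ p _ hX1 _ hr0
    exact h W p hX1 hr0

/-- **The typed TARGET implies the typed INPUT on `r_an = 0`**: `BSDpOnClassX1` ⟹ Mazur's main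
conjecture at every X1 pair of analytic rank `0` — the converse of prover A's
`bsdp_of_classX1_typeA_of_analyticRank_eq_zero` (same published facts).
[cite: GreenbergLNM1716, Thm. 4.1 and §5 (closing examples)] [cite: Wuthrich2014, Thm. 16 (p. 393)] -/
theorem mazurMainConjecture_of_bsdpOnClassX1 (hB : BSDpOnClassX1)
    (hW16 : Wuthrich2014.charIdeal_dvd_padicLFunction) (hGr : greenberg_charValue_rankZero)
    (hmod : nonempty_modularParametrizationData) (hGZK : rank_eq_analyticRank_of_analyticRank_le_one)
    (W : WeierstrassCurve ℚ) [W.IsElliptic] [W.IsGloballyMinimal] (p : ℕ) [Fact p.Prime]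
    (hX1 : ClassX1 W p) (hr0 : W.analyticRank = 0) : MazurMainConjecture W p :=
  (mazurMainConjecture_iff_bsdp hW16 hGr hmod hGZK W p hX1 hr0).mpr
    (hB W p hX1 (by rw [hr0]; exact zero_le_one))

/-- **Per-pair: `p ∤ #Ш(E/ℚ)_an` ⟹ `MazurMainConjecture W p`** at an X1 pair with `L(E,1) ≠ 0`
(Wuthrich 2014 Prop. 21 `hW` gives `BSD(E,p)`; then the converse chain). Census examples, all with
`#Ш_an = 1`: `11a1@5` (Greenberg's `E_1`, `char_Λ X = (5)`), `14a1@3`, `26b1@7`.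
[cite: GreenbergLNM1716, §5 (Conductor = 11; Conductor = 26, p = 7)]
[cite: Wuthrich2014, Thm. 16 (p. 393) and Prop. 21 (p. 400)] -/
theorem mazurMainConjecture_of_shaAn_unit (hW : Wuthrich2014.sha_dvd_analyticSha)
    (hW16 : Wuthrich2014.charIdeal_dvd_padicLFunction) (hGr : greenberg_charValue_rankZero)
    (hGZK : rank_eq_analyticRank_of_analyticRank_le_one)
    (W : WeierstrassCurve ℚ) [W.IsElliptic] [W.IsGloballyMinimal] (p : ℕ) [Fact p.Prime]
    (hX1 : ClassX1 W p) (hL : W.entireLFunction 1 ≠ 0)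
    (hunit : ∃ q : ℚ, shaAn W = (q : ℂ) ∧ padicValRat p q = 0) : MazurMainConjecture W p := by
  intro κ γ hκ hγ hγ' _ f hf ϖ hϖ D
  exact X1.mainConjecture_of_shaAn_unit hW hW16 hGr hGZK W p hX1 hL hunit hκ hγ hγ' hf D ϖ hϖ

/-- **Per-pair, up to isogeny: `p ∤ #Ш(E'/ℚ)_an` for a `ℚ`-isogenous `E'` ⟹ `MazurMainConjecture W p`**
(`(E,p)` an X1 pair with `L(E,1) ≠ 0`; `W' ∼ W` globally minimal with `p` an odd good anomalous
Eisenstein prime of `E'`, `IsClassX1 W' p`; Wuthrich Prop. 21 for `E'`, Cassels' invariance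
`hCassels`, then the converse chain). Census examples: `2366d1@3`, `7154c1@3` via `2366d2`, `7154c2`.
[cite: GreenbergLNM1716, §5 (Conductor = 34: conjecture 1.13 is preserved by ℚ-isogeny)]
[cite: Wuthrich2014, Prop. 21 (p. 400)] [cite: MilneADT2006, Thm. I.7.3] -/
theorem mazurMainConjecture_of_isIsogenous_of_shaAn_unit (hW : Wuthrich2014.sha_dvd_analyticSha)
    (hW16 : Wuthrich2014.charIdeal_dvd_padicLFunction) (hGr : greenberg_charValue_rankZero)
    (hGZK : rank_eq_analyticRank_of_analyticRank_le_one) (hCassels : bsdRHS_eq_of_isIsogenous)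
    (W W' : WeierstrassCurve ℚ) [W.IsElliptic] [W'.IsElliptic] [W.IsGloballyMinimal]
    [W'.IsGloballyMinimal] (hiso : IsIsogenous W W') (p : ℕ) [Fact p.Prime]
    (hX1 : ClassX1 W p) (hX1' : IsClassX1 W' p) (hL : W.entireLFunction 1 ≠ 0)
    (hunit' : ∃ q : ℚ, shaAn W' = (q : ℂ) ∧ padicValRat p q = 0) : MazurMainConjecture W p := by
  intro κ γ hκ hγ hγ' _ f hf ϖ hϖ D
  exact X1.mainConjecture_of_isIsogenous_of_shaAn_unit hW hW16 hGr hGZK hCassels W W' hiso p hX1 hX1'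
    hL hunit' hκ hγ hγ' hf D ϖ hϖ

/-! ### The finite sub-class in print: conductor `< 5000` (appended 2026-08-18, gen 2) -/

/-- **`MazurMainConjecture W p` at every rank-`0` X1 pair of conductor `< 5000`** — a theorem of the
published record: Miller 2011 Thm. 1.2 / Creutz–Miller 2012 (`hM` = `bsdp_of_reducible_of_conductor_lt`:
`BSD(E,p)` for `r_an ≤ 1`, `N_E < 5000`, `E[p]` reducible) composed with the converse chain (Wuthrich
2014 Thm. 16 `hW16`, Greenberg 1999 Thm. 4.1 `hGr`, Gross–Zagier–Kolyvagin `hGZK`; modularity `hmod`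
for `r_an = 0 ⇒ L(E,1) ≠ 0`). Covers Greenberg's `11a1@5`, `14a1@3`, `26b1@7` with no numerical
hypothesis in the statement. [cite: Miller2011LMS, Thm. 1.2 (arXiv:1010.2431 p. 3)]
[cite: CreutzMiller2012, Thm. 1.1 and §7.1] [cite: GreenbergLNM1716, §5 (Conductor = 11, 14, 26)] -/
theorem mazurMainConjecture_of_conductor_lt (hM : bsdp_of_reducible_of_conductor_lt)
    (hW16 : Wuthrich2014.charIdeal_dvd_padicLFunction) (hGr : greenberg_charValue_rankZero)
    (hmod : nonempty_modularParametrizationData) (hGZK : rank_eq_analyticRank_of_analyticRank_le_one)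
    (W : WeierstrassCurve ℚ) [W.IsElliptic] [W.IsGloballyMinimal] (p : ℕ) [Fact p.Prime]
    (hX1 : ClassX1 W p) (hr0 : W.analyticRank = 0) (hN : W.conductorNorm ℤ < 5000) :
    MazurMainConjecture W p := by
  intro κ γ hκ hγ hγ' _ f hf ϖ hϖ D
  exact X1.mainConjecture_of_conductor_lt hM hW16 hGr hGZK W p hX1
    (entireLFunction_one_ne_zero_of_analyticRank_eq_zero hmod W hr0) hN hκ hγ hγ' hf D ϖ hϖ

/-- **The typed missing input `MazurMainConjectureOnX1TypeA`, restricted to analytic rank `0` and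
conductor `< 5000`, is a theorem of the published record** (same inputs).
[cite: Miller2011LMS, Thm. 1.2 (arXiv:1010.2431 p. 3)] [cite: CreutzMiller2012, Thm. 1.1 and §7.1] -/
theorem mazurMainConjectureOnX1_rankZero_of_conductor_lt (hM : bsdp_of_reducible_of_conductor_lt)
    (hW16 : Wuthrich2014.charIdeal_dvd_padicLFunction) (hGr : greenberg_charValue_rankZero)
    (hmod : nonempty_modularParametrizationData) (hGZK : rank_eq_analyticRank_of_analyticRank_le_one) :
    ∀ (W : WeierstrassCurve ℚ) [W.IsElliptic] [W.IsGloballyMinimal] (p : ℕ) [Fact p.Prime],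
      ClassX1 W p → W.analyticRank = 0 → W.conductorNorm ℤ < 5000 → MazurMainConjecture W p :=
  fun W _ _ p _ hX1 hr0 hN ↦ mazurMainConjecture_of_conductor_lt hM hW16 hGr hmod hGZK W p hX1 hr0 hN

end Summit.BirchSwinnertonDyer.BirchSwinnertonDyer.Theorems.Rank1ResidualX1Converse

end
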